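/-
Copyright (c) 2026. All rights reserved.
Released under Apache 2.0 license as described in the file LICENSE.
-/
import Literature.AlgebraicGeometry.ComplexMultiplication.HyperellipticJacobianDimensionAndSimplicity
import Literature.AlgebraicGeometry.ComplexMultiplication.HyperellipticJacobianLevelTwelve
import Literature.AlgebraicGeometry.ComplexMultiplication.QuadraticCMFieldFamiliesSeparating
import Literature.AlgebraicGeometry.Pohlmann1968.StablyNondegenerateInducedCMProducts
import HarnessLib

/-!
# The Hodge conjecture for everything isogenous to a product of the CM pieces of `J_m = J(y² = x^m − 1)`, `m ∣ 24`
# (GGL 2024 Thm. 3.0 at the elliptic levels: products of CM elliptic curves with CM by `ℚ(√−3), ℚ(i), ℚ(√−2), ℚ(√−6)`)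

Layer `Literature/AlgebraicGeometry/ComplexMultiplication`, namespace `…ComplexMultiplication.HyperellipticJacobian`; a sequel of
`HyperellipticJacobianProductsOfEllipticCurves` (F29: `J_m ∼` a product of elliptic curves iff `m ∈ {3, 4, 6, 8, 12, 24}`, the divisors
`≥ 3` of `24`) drawing the HODGE-THEORETIC consequence.  THEOREMS ONLY (no definition, no named fact, no `sorry`, no instance).

THE PRINT.  Gallese–Goodson–Lombardo [GalleseGoodsonLombardo2024] (held `paper:arxiv-2405.20394`), §3 Thm. 3.0 (p. 12): `J_m ∼ ∏_{d ∣ m,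
d ≠ 1, 2} X_d`, `X_d` of CM type `(ℚ(ζ_d); Φ_d)` with `Φ_d` the lower half; (2)–(3) `X_d` simple for `d` odd, `X_d ∼ X_{d/2}` for
`d ≡ 2 (mod 4)`; (5) for `4 ∣ d ∉ {20, 24, 60}`, `X_d ∼ Y_d²` with `Y_d` simple with CM by `ℚ(ζ_d − ζ_d^{−1})` (§3.3, p. 13); §3.4 (p. 14)
«for `m = 24` … the CM field of the elliptic curve `Y_{24}` is `ℚ(√−6)`»; Lemma 14 (p. 14) the endomorphism algebras.  At the levels
`d ∈ {3, 4, 6, 8, 12, 24}` — the divisors `≥ 3` of `24` — every simple factor is an ELLIPTIC CURVE (`φ(d)/2 = 1` or `φ(d)/4 = 1`), with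
CM by `ℚ(√−3)` (`d = 3, 6`), `ℚ(i)` (`d = 4, 12`: `ℚ(ζ_{12} − ζ_{12}^{−1}) = ℚ(i)`), `ℚ(√−2)` (`d = 8`: `ℚ(ζ_8 − ζ_8^{−1}) = ℚ(√−2)`),
`ℚ(√−6)` (`d = 24`).  Moonen–Zarhin [MoonenZarhin1999LowDim] Cor. (3.9) ∕ Imai: a product of CM elliptic curves `E_1^{n_1} × ⋯ × E_r^{n_r}`
with PAIRWISE NON-ISOGENOUS `E_i` (CM fields `ℚ(√−d_i)`, `d_i d_j` not a square) has Hodge ring generated by divisor classes, so the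
Hodge conjecture holds for it; the tree has this as `isNondegenerateFamily_of_sq_eq_neg` (file `QuadraticCMFieldFamiliesSeparating`,
whose census namespace `Census1236` is exactly the four fields `ℚ(√−1), ℚ(√−2), ℚ(√−3), ℚ(√−6)` met here) and the isogeny-invariant
product form `CMAlgebra.IsNondegenerateFamily.hodgeConjectureFor_of_isIsogenous_prod_inducedCMType` (Gordon 7.5–7.6.1, Shimura §6.2 Thm. 3).

WHAT IS PROVED (read, as in F24–F31, on the abstract decomposition: a finite family `C_j ⊨ (ℚ(ζ_{e_j}); Ψ_j)` of realisations of
the lower-half types, one member for each divisor `e ≥ 3` of `m`).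
* §1 The square roots generating the CM fields of the elliptic factors inside `ℚ(ζ_d)`: `(2ζ_3 + 1)² = −3`, `ζ_4² = −1`,
  `(2ζ_6² + 1)² = −3`, `(ζ_8 − ζ_8^{−1})² = −2`, `(ζ_{12} − ζ_{12}^{−1})² = −1` (Lemma 14's `ℚ(ζ_m − ζ_m^{−1})` at `m = 8, 12`).
* §2 DESCENT TO AN IMAGINARY QUADRATIC FIELD at every elliptic level `d ∈ {3, 4, 6, 8, 12, 20, 24}`: the lower-half type `Φ_d` is
  induced from a CM type `Φ₁` of a subfield `K₁ ⊆ ℚ(ζ_d)` with `[K₁ : ℚ] = 2` containing `a` with `a² = −3, −1, −3, −2, −1, −5, −6`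
  respectively (`exists_quadratic_subpair`; at `d = 3, 4, 6` `K₁ = ℚ(ζ_d)` itself; at `8, 12` Thm. 3.0 (5)'s `ℚ(ζ_d − ζ_d^{−1})`, tree
  `eq_fixedField_and_eq_adjoin_of_primitive_of_four_dvd`; at `20, 24` §3.4's `ℚ(√−5)`, `ℚ(√−6)`, tree `primitiveSubfield_twenty[Four]`).
* §3 CONTRACTION inside the `J_m`-family for `m ∣ 24`: every member is isogenous to a power of a member of level `3, 4, 8` or `24`
  (`X_6 ∼ X_3`, Thm. 3.0 (4); `X_{12} ∼ X_4²`, tree `isIsogenous_twelve_biproduct_four`).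
* §4 THE HODGE CONJECTURE, and `𝓑^p = 𝓓^p` for every `p`, FOR EVERY COMPLEX ABELIAN VARIETY ISOGENOUS TO A PRODUCT `⨁_k C_{π k}` OF
  MEMBERS OF THE `J_m`-FAMILY, `m ∣ 24`, `m ≥ 3` — in particular for `J_m = ⨁_j C_j` itself and for all its powers `J_mⁿ`
  (`hodge_of_isIsogenous_prod_of_dvd_twentyFour[']`, `hodge_biproduct_of_dvd_twentyFour`, `hodge_of_isIsogenous_pow_biproduct_of_dvd_twentyFour`):
  the members of levels `3, 4, 8, 24` realise types induced from the imaginary quadratic fields `ℚ(√−3), ℚ(i), ℚ(√−2), ℚ(√−6)`, whose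
  discriminant products `d_i d_j ∈ {3, 6, 18, 2, 6, 12}` are not squares, so the descended family is nondegenerate (Moonen–Zarhin Cor. 3.9 in
  the tree's rank form), and Gordon 7.5 (3) ⟹ (1) up to isogeny concludes.  A KNOWN case of the Hodge conjecture (products of CM elliptic
  curves); nothing here bears on the open cases, and `HC_CM` is not advanced by it.
* §5 One level: at each elliptic level `d ∈ {3, 4, 6, 8, 12, 20, 24}` every abelian variety isogenous to a power `X_dⁿ` of a realisation of
  `Φ_d` has `𝓑 = 𝓓` and satisfies the Hodge conjecture (`hodge_of_isIsogenous_pow_of_ellipticLevel`; powers of one CM elliptic curve).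

HONEST REGISTER.  The curve `C_m` and `J_m` are not constructed: «`J_m`» is the abstract biproduct of a divisor-indexed family of
realisations of the lower-half types (Thm. 3.0 read as hypothesis, as in F24–F31).  The identification of the CM fields is typed only
as «`K₁` is an imaginary quadratic subfield of `ℚ(ζ_d)` containing a square root of `−d'`» (which determines it); the `j`-invariants,
fields of definition and class numbers of §3.4 are not typed.  Levels `20` (`m ∤ 24`) and `60` are outside §4 (at `m = 20` the family
`X_4, X_5, X_{10}, X_{20}` has the non-elliptic simple factor `X_5`; F29).
-/

noncomputable section

open CategoryTheory CategoryTheory.Limits NumberField Module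

namespace Literature.AlgebraicGeometry.ComplexMultiplication

open Literature.AlgebraicGeometry.Motives
open Literature.AlgebraicGeometry.Motives.AbelianVariety
open Literature.AlgebraicGeometry.Milne1999
open Literature.AlgebraicGeometry.HodgeTheory (complexBetti HodgeConjectureFor)
open Literature.AlgebraicGeometry.VanGeemen1994 (hodgeClassSpan)
open Literature.Barriers.HodgeConjecture (divisorClassesSpan)
open Literature.NumberTheory.ComplexMultiplication

namespace HyperellipticJacobian

open Literature.AlgebraicGeometry.Pohlmann1968 Literature.AlgebraicGeometry.Pohlmann1968.Cyclotomic

/-! ## §1 Square roots of `−3, −1, −3, −2, −1` in `ℚ(ζ_3), ℚ(ζ_4), ℚ(ζ_6), ℚ(ζ_8), ℚ(ζ_{12})` -/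

section SquareRoots

variable {K : Type} [Field K] [NumberField K]

/-- `(2ζ_3 + 1)² = −3` in `ℚ(ζ_3) = ℚ(√−3)` (the CM field of `X_3 : y² = x³ + 1`). [cite: GalleseGoodsonLombardo2024, §3 Thm. 3.0 (1)–(2) and Lemma 14] -/
theorem sq_two_mul_zetaOf_three_add_one [IsCyclotomicExtension {3} ℚ K] : (2 * zetaOf 3 K + 1) ^ 2 = -3 := by
  have hζ : IsPrimitiveRoot (zetaOf 3 K) 3 := IsCyclotomicExtension.zeta_spec 3 ℚ K
  have h := hζ.geom_sum_eq_zero (by norm_num : 1 < 3)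
  rw [Finset.sum_range_succ, Finset.sum_range_succ, Finset.sum_range_succ, Finset.sum_range_zero] at h
  linear_combination (4 : K) * h

/-- `ζ_4² = −1` in `ℚ(ζ_4) = ℚ(i)` (the CM field of `X_4 : y² = x³ − x`). [cite: GalleseGoodsonLombardo2024, §3 Thm. 3.0 (1) and Lemma 14] -/
theorem sq_zetaOf_four [IsCyclotomicExtension {4} ℚ K] : zetaOf 4 K ^ 2 = -1 :=
  ((IsCyclotomicExtension.zeta_spec 4 ℚ K).pow (by norm_num) (show 4 = 2 * 2 from rfl)).eq_neg_one_of_two_right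

/-- `(2ζ_6² + 1)² = −3` in `ℚ(ζ_6) = ℚ(ζ_3) = ℚ(√−3)` (the CM field of `X_6 ∼ X_3`). [cite: GalleseGoodsonLombardo2024, §3 Thm. 3.0 (4) and Lemma 14] -/
theorem sq_two_mul_zetaOf_six_sq_add_one [IsCyclotomicExtension {6} ℚ K] : (2 * zetaOf 6 K ^ 2 + 1) ^ 2 = -3 := by
  have hζ : IsPrimitiveRoot (zetaOf 6 K) 6 := IsCyclotomicExtension.zeta_spec 6 ℚ K
  have h := (hζ.pow (by norm_num) (show 6 = 2 * 3 from rfl)).geom_sum_eq_zero (by norm_num : 1 < 3)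
  rw [Finset.sum_range_succ, Finset.sum_range_succ, Finset.sum_range_succ, Finset.sum_range_zero] at h
  linear_combination (4 : K) * h

/-- `(ζ_8 − ζ_8^{−1})² = −2`: Thm. 3.0 (5)'s CM field `ℚ(ζ_8 − ζ_8^{−1})` of `Y_8` is `ℚ(√−2)`. [cite: GalleseGoodsonLombardo2024, §3 Thm. 3.0 (5), §3.3 and Lemma 14] -/
theorem sq_zetaOf_sub_inv_eight [IsCyclotomicExtension {8} ℚ K] : (zetaOf 8 K - (zetaOf 8 K)⁻¹) ^ 2 = -2 := by
  have hζ : IsPrimitiveRoot (zetaOf 8 K) 8 := IsCyclotomicExtension.zeta_spec 8 ℚ K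
  have h8 : zetaOf 8 K ^ 8 = 1 := hζ.pow_eq_one
  have h4 : zetaOf 8 K ^ 4 = -1 := (hζ.pow (by norm_num) (show 8 = 4 * 2 from rfl)).eq_neg_one_of_two_right
  have hinv : (zetaOf 8 K)⁻¹ = zetaOf 8 K ^ 7 := inv_eq_of_mul_eq_one_right (by rw [← pow_succ']; exact h8)
  rw [hinv]
  linear_combination (zetaOf 8 K ^ 6 - 2) * h8 + zetaOf 8 K ^ 2 * h4

/-- `(ζ_{12} − ζ_{12}^{−1})² = −1`: Thm. 3.0 (5)'s CM field `ℚ(ζ_{12} − ζ_{12}^{−1})` of `Y_{12}` is `ℚ(i)` (`Y_{12} ∼ X_4`).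
[cite: GalleseGoodsonLombardo2024, §3 Thm. 3.0 (5), §3.3 and Lemma 14] -/
theorem sq_zetaOf_sub_inv_twelve [IsCyclotomicExtension {12} ℚ K] : (zetaOf 12 K - (zetaOf 12 K)⁻¹) ^ 2 = -1 := by
  have hζ : IsPrimitiveRoot (zetaOf 12 K) 12 := IsCyclotomicExtension.zeta_spec 12 ℚ K
  have h12 : zetaOf 12 K ^ 12 = 1 := hζ.pow_eq_one
  have h6 : zetaOf 12 K ^ 6 = -1 := (hζ.pow (by norm_num) (show 12 = 6 * 2 from rfl)).eq_neg_one_of_two_right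
  have h3 := (hζ.pow (by norm_num) (show 12 = 4 * 3 from rfl)).geom_sum_eq_zero (by norm_num : 1 < 3)
  rw [Finset.sum_range_succ, Finset.sum_range_succ, Finset.sum_range_succ, Finset.sum_range_zero] at h3
  have hinv : (zetaOf 12 K)⁻¹ = zetaOf 12 K ^ 11 := inv_eq_of_mul_eq_one_right (by rw [← pow_succ']; exact h12)
  rw [hinv]
  linear_combination (zetaOf 12 K ^ 10 - 2) * h12 + (zetaOf 12 K ^ 4 + zetaOf 12 K ^ 2) * h6 - h3

end SquareRoots

/-! ## §2 Descent of the lower-half type to an imaginary quadratic subfield at every elliptic level -/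

section Descent

variable {N : ℕ} [NeZero N] {K : Type} [Field K] [NumberField K] [IsCyclotomicExtension {N} ℚ K]

omit [NeZero N] [IsCyclotomicExtension {N} ℚ K] in
/-- Every CM type is induced from a CM type of the top intermediate field (transport along `K ≃ ⊤`). [folklore] -/
private theorem exists_inducedCMType_top_eq (Φ : CMType K) :
    ∃ Φ₁ : CMType (⊤ : IntermediateField ℚ K), inducedCMType (algebraMap (⊤ : IntermediateField ℚ K) K) Φ₁ = Φ := by
  refine ⟨inducedCMType ((IntermediateField.topEquiv (F := ℚ) (E := K)).symm : K →+* (⊤ : IntermediateField ℚ K)) Φ, ?_⟩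
  rw [← inducedCMType_comp]
  have hcomp : (algebraMap (⊤ : IntermediateField ℚ K) K).comp
      ((IntermediateField.topEquiv (F := ℚ) (E := K)).symm : K →+* (⊤ : IntermediateField ℚ K)) = RingHom.id K := by
    ext x
    simp
  rw [hcomp, inducedCMType_id]

omit [NeZero N] [IsCyclotomicExtension {N} ℚ K] in
/-- A square root in `K` of `−d` gives one in the top intermediate field. [folklore] -/
private theorem exists_sq_eq_neg_top {a₀ : K} {d : ℕ} (h : a₀ ^ 2 = -(d : K)) :
    ∃ a : (⊤ : IntermediateField ℚ K), a ^ 2 = -(d : (⊤ : IntermediateField ℚ K)) := by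
  refine ⟨⟨a₀, IntermediateField.mem_top⟩, Subtype.coe_injective ?_⟩
  push_cast
  exact h

omit [NeZero N] [IsCyclotomicExtension {N} ℚ K] in
/-- A square root in `K` of `−d` lying in an intermediate field `K₁` gives one in `K₁`. [folklore] -/
private theorem exists_sq_eq_neg_of_mem {K₁ : IntermediateField ℚ K} {a₀ : K} {d : ℕ} (ha₀ : a₀ ∈ K₁) (h : a₀ ^ 2 = -(d : K)) :
    ∃ a : K₁, a ^ 2 = -(d : K₁) := by
  refine ⟨⟨a₀, ha₀⟩, Subtype.coe_injective ?_⟩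
  push_cast
  exact h

/-- `[ℚ(ζ_N) : ℚ] = φ(N)`. [folklore] -/
private theorem finrank_eq_totient' : Module.finrank ℚ K = N.totient :=
  IsCyclotomicExtension.finrank (K := ℚ) (n := N) K (Polynomial.cyclotomic.irreducible_rat (Nat.pos_of_ne_zero (NeZero.ne N)))

/-- **THE CM FIELDS OF THE ELLIPTIC SIMPLE FACTORS (Thm. 3.0 with §3.3–§3.4 and Lemma 14, at the levels where `X_d` or `Y_d` is an
elliptic curve).**  For `N ∈ {3, 4, 6, 8, 12, 20, 24}` and the lower-half type `Φ` of `K = ℚ(ζ_N)` there are an intermediate field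
`K₁ ⊆ K` with `[K₁ : ℚ] = 2`, a CM type `Φ₁` of `K₁` INDUCING `Φ` (`Φ₁^K = Φ`), and `a ∈ K₁` with `a² = −d`, where `d = 3` (`N = 3, 6`:
`K₁ = K = ℚ(√−3)`), `d = 1` (`N = 4`: `K₁ = K = ℚ(i)`; `N = 12`: `K₁ = ℚ(ζ_{12} − ζ_{12}^{−1}) = ℚ(i)`), `d = 2` (`N = 8`:
`K₁ = ℚ(ζ_8 − ζ_8^{−1}) = ℚ(√−2)`), `d = 5` (`N = 20`: `ℚ(√−5)`), `d = 6` (`N = 24`: `ℚ(√−6)`).  So every simple factor at these levels is an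
elliptic curve with CM by `ℚ(√−d)` (Shimura §6.2 Thm. 3). [cite: GalleseGoodsonLombardo2024, §3 Thm. 3.0 (1)–(5), §3.3, §3.4 and Lemma 14]
[cite: Shimura1998, §8.2 Prop. 26] -/
theorem exists_quadratic_subpair (hN : N = 3 ∨ N = 4 ∨ N = 6 ∨ N = 8 ∨ N = 12 ∨ N = 20 ∨ N = 24) (Φ : CMType K)
    (hΦ : ∀ σ : K →+* ℂ, σ ∈ Φ.1 ↔ 2 * (expOf N K σ).val < N) :
    ∃ (K₁ : IntermediateField ℚ K) (Φ₁ : CMType K₁) (a : K₁) (d : ℕ),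
      inducedCMType (algebraMap K₁ K) Φ₁ = Φ ∧ Module.finrank ℚ K₁ = 2 ∧ a ^ 2 = -(d : K₁) ∧
      ((N = 3 ∨ N = 6) ∧ d = 3 ∨ (N = 4 ∨ N = 12) ∧ d = 1 ∨ N = 8 ∧ d = 2 ∨ N = 20 ∧ d = 5 ∨ N = 24 ∧ d = 6) := by
  have hdegK : Module.finrank ℚ K = N.totient := finrank_eq_totient' (N := N) (K := K)
  have htop : Module.finrank ℚ (⊤ : IntermediateField ℚ K) = N.totient := by rw [IntermediateField.finrank_top', hdegK]
  rcases hN with rfl | rfl | rfl | rfl | rfl | rfl | rfl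
  · -- `N = 3`: `K₁ = K = ℚ(√−3)`
    obtain ⟨Φ₁, h₁⟩ := exists_inducedCMType_top_eq Φ
    obtain ⟨a, ha⟩ := exists_sq_eq_neg_top (K := K) (d := 3) (by exact_mod_cast sq_two_mul_zetaOf_three_add_one (K := K))
    exact ⟨⊤, Φ₁, a, 3, h₁, by rw [htop]; decide, ha, Or.inl ⟨Or.inl rfl, rfl⟩⟩
  · -- `N = 4`: `K₁ = K = ℚ(i)`
    obtain ⟨Φ₁, h₁⟩ := exists_inducedCMType_top_eq Φ
    obtain ⟨a, ha⟩ := exists_sq_eq_neg_top (K := K) (d := 1) (by exact_mod_cast sq_zetaOf_four (K := K))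
    exact ⟨⊤, Φ₁, a, 1, h₁, by rw [htop]; decide, ha, Or.inr (Or.inl ⟨Or.inl rfl, rfl⟩)⟩
  · -- `N = 6`: `K₁ = K = ℚ(√−3)`
    obtain ⟨Φ₁, h₁⟩ := exists_inducedCMType_top_eq Φ
    obtain ⟨a, ha⟩ := exists_sq_eq_neg_top (K := K) (d := 3) (by exact_mod_cast sq_two_mul_zetaOf_six_sq_add_one (K := K))
    exact ⟨⊤, Φ₁, a, 3, h₁, by rw [htop]; decide, ha, Or.inl ⟨Or.inr rfl, rfl⟩⟩
  · -- `N = 8`: the primitive sub-pair, `K₁ = ℚ(ζ − ζ⁻¹) = ℚ(√−2)`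
    obtain ⟨K₁, Φ₁, h₁, hp₁, -⟩ := exists_primitive_inducedCMType_eq Φ
    obtain ⟨-, -, -, -, -, hmem, -, hdeg, -⟩ :=
      eq_fixedField_and_eq_adjoin_of_primitive_of_four_dvd (m := 8) ⟨2, rfl⟩ le_rfl (by norm_num) (by norm_num) (by norm_num)
        Φ hΦ Φ₁ h₁ hp₁
    obtain ⟨a, ha⟩ := exists_sq_eq_neg_of_mem (d := 2) hmem (by exact_mod_cast sq_zetaOf_sub_inv_eight (K := K))
    refine ⟨K₁, Φ₁, a, 2, h₁, ?_, ha, Or.inr (Or.inr (Or.inl ⟨rfl, rfl⟩))⟩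
    rw [show Nat.totient 8 = 4 by decide] at hdeg
    omega
  · -- `N = 12`: the primitive sub-pair, `K₁ = ℚ(ζ − ζ⁻¹) = ℚ(i)`
    obtain ⟨K₁, Φ₁, h₁, hp₁, -⟩ := exists_primitive_inducedCMType_eq Φ
    obtain ⟨-, -, -, -, -, hmem, -, hdeg, -⟩ :=
      eq_fixedField_and_eq_adjoin_of_primitive_of_four_dvd (m := 12) ⟨3, rfl⟩ (by norm_num) (by norm_num) (by norm_num)
        (by norm_num) Φ hΦ Φ₁ h₁ hp₁
    obtain ⟨a, ha⟩ := exists_sq_eq_neg_of_mem (d := 1) hmem (by exact_mod_cast sq_zetaOf_sub_inv_twelve (K := K))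
    refine ⟨K₁, Φ₁, a, 1, h₁, ?_, ha, Or.inr (Or.inl ⟨Or.inr rfl, rfl⟩)⟩
    rw [show Nat.totient 12 = 4 by decide] at hdeg
    omega
  · -- `N = 20`: `K₁ = ℚ(√−5)` (§3.4)
    obtain ⟨K₁, Φ₁, h₁, hp₁, -⟩ := exists_primitive_inducedCMType_eq Φ
    obtain ⟨hr2, hrK, -, hdeg₁, -⟩ := primitiveSubfield_twenty Φ hΦ Φ₁ h₁ hp₁
    obtain ⟨a, ha⟩ := exists_sq_eq_neg_of_mem (d := 5) hrK (by exact_mod_cast hr2)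
    exact ⟨K₁, Φ₁, a, 5, h₁, hdeg₁, ha, Or.inr (Or.inr (Or.inr (Or.inl ⟨rfl, rfl⟩)))⟩
  · -- `N = 24`: `K₁ = ℚ(√−6)` (§3.4)
    obtain ⟨K₁, Φ₁, h₁, hp₁, -⟩ := exists_primitive_inducedCMType_eq Φ
    obtain ⟨hr2, hrK, -, hdeg₁, -⟩ := primitiveSubfield_twentyFour Φ hΦ Φ₁ h₁ hp₁
    obtain ⟨a, ha⟩ := exists_sq_eq_neg_of_mem (d := 6) hrK (by exact_mod_cast hr2)
    exact ⟨K₁, Φ₁, a, 6, h₁, hdeg₁, ha, Or.inr (Or.inr (Or.inr (Or.inr ⟨rfl, rfl⟩)))⟩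

end Descent

/-! ## §3 Contraction inside the `J_m`-family, `m ∣ 24`: every member is isogenous to a power of a member of level `3, 4, 8, 24` -/

section Contraction

variable {N N' : ℕ} [NeZero N] [NeZero N'] {L : Type} [Field L] [NumberField L] [IsCyclotomicExtension {N} ℚ L]
  {L' : Type} [Field L'] [NumberField L'] [IsCyclotomicExtension {N'} ℚ L'] {Φ : CMType L} {Φ' : CMType L'}
  {A : AbelianVariety ℂ} {ι : 𝓞 L →+* End A} {θ : L →+* Module.End ℂ (complexBetti A.X 1)}
  {B : AbelianVariety ℂ} {ι' : 𝓞 L' →+* End B} {θ' : L' →+* Module.End ℂ (complexBetti B.X 1)}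

/-- **Thm. 3.0 (4), level-equation form: `X_{2n} ∼ X_n`** (`n` odd `≥ 3`; the tree's `isIsogenous_twiceOdd` with the levels given by
equations, for use on members of an indexed family). [cite: GalleseGoodsonLombardo2024, §3 Thm. 3.0 (4) and §3.2] -/
theorem isIsogenous_of_level_eq_twice {n : ℕ} (hn : Odd n) (h3 : 3 ≤ n) (hN : N = 2 * n) (hN' : N' = n)
    (hΦ : ∀ σ : L →+* ℂ, σ ∈ Φ.1 ↔ 2 * (expOf N L σ).val < N) (hΦ' : ∀ σ : L' →+* ℂ, σ ∈ Φ'.1 ↔ 2 * (expOf N' L' σ).val < N')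
    (hA : IsCMTypeRealisation Φ A ι θ) (hB : IsCMTypeRealisation Φ' B ι' θ') : IsIsogenous A B := by
  subst hN hN'
  exact isIsogenous_twiceOdd hn h3 hΦ hΦ' hA hB

/-- **`X_{12} ∼ X_4²`, level-equation form** (the tree's `isIsogenous_twelve_biproduct_four`). [cite: GalleseGoodsonLombardo2024, §3 Thm. 3.0 (5) and Lemma 12] -/
theorem isIsogenous_biproduct_two_of_level_eq_twelve_four (hN : N = 12) (hN' : N' = 4)
    (hΦ : ∀ σ : L →+* ℂ, σ ∈ Φ.1 ↔ 2 * (expOf N L σ).val < N) (hΦ' : ∀ σ : L' →+* ℂ, σ ∈ Φ'.1 ↔ 2 * (expOf N' L' σ).val < N')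
    (hA : IsCMTypeRealisation Φ A ι θ) (hB : IsCMTypeRealisation Φ' B ι' θ') : IsIsogenous A (⨁ fun _ : Fin 2 => B) := by
  subst hN hN'
  exact isIsogenous_twelve_biproduct_four hΦ' hB hΦ hA

end Contraction

section Family

variable {κ : Type} [Fintype κ] {lev : κ → ℕ} [∀ j, NeZero (lev j)] {F : κ → Type} [∀ j, Field (F j)]
  [∀ j, NumberField (F j)] [∀ j, IsCyclotomicExtension {lev j} ℚ (F j)] {Ψ : ∀ j, CMType (F j)} {C : κ → AbelianVariety ℂ}
  {ιC : ∀ j, 𝓞 (F j) →+* End (C j)} {θC : ∀ j, F j →+* Module.End ℂ (complexBetti (C j).X 1)}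

omit [Fintype κ] in
/-- **Every member of the `J_m`-family, `m ∣ 24`, is isogenous to a power of a member of level `3, 4, 8` or `24`**: the levels are the
divisors `≥ 3` of `m`, so among `3, 4, 6, 8, 12, 24`; `X_6 ∼ X_3` (Thm. 3.0 (4)), `X_{12} ∼ X_4²` (Thm. 3.0 (5), Lemma 12), the others are
their own first powers. [cite: GalleseGoodsonLombardo2024, §3 Thm. 3.0 (4)–(5) and Lemma 12] [cite: MumfordAV1970, §19 Cor. 1 (p. 173)] -/
theorem exists_isIsogenous_biproduct_const_of_dvd_twentyFour {m : ℕ} (hm24 : m ∣ 24) (hlev : ∀ d, (∃ j, lev j = d) ↔ d ∣ m ∧ 3 ≤ d)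
    (hΨ : ∀ j (σ : F j →+* ℂ), σ ∈ (Ψ j).1 ↔ 2 * (expOf (lev j) (F j) σ).val < lev j)
    (hC : ∀ j, IsCMTypeRealisation (Ψ j) (C j) (ιC j) (θC j)) (j : κ) :
    ∃ (j' : κ) (h : ℕ), (lev j' = 3 ∨ lev j' = 4 ∨ lev j' = 8 ∨ lev j' = 24) ∧ IsIsogenous (C j) (⨁ fun _ : Fin h => C j') := by
  obtain ⟨hdvd, h3⟩ := (hlev (lev j)).1 ⟨j, rfl⟩
  have hmem : lev j ∈ Nat.divisors 24 := Nat.mem_divisors.2 ⟨dvd_trans hdvd hm24, by norm_num⟩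
  have key : ∀ e ∈ Nat.divisors 24, 3 ≤ e → e = 3 ∨ e = 4 ∨ e = 8 ∨ e = 24 ∨ e = 6 ∨ e = 12 := by decide
  have hself : IsIsogenous (C j) (⨁ fun _ : Fin 1 => C j) := (isIsogenous_biproduct_of_subsingleton (0 : Fin 1) fun _ => C j).symm'
  rcases key _ hmem h3 with h | h | h | h | h6 | h12
  · exact ⟨j, 1, Or.inl h, hself⟩
  · exact ⟨j, 1, Or.inr (Or.inl h), hself⟩
  · exact ⟨j, 1, Or.inr (Or.inr (Or.inl h)), hself⟩
  · exact ⟨j, 1, Or.inr (Or.inr (Or.inr h)), hself⟩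
  · -- `X_6 ∼ X_3`
    obtain ⟨j₃, hj₃⟩ := (hlev 3).2 ⟨dvd_trans (by norm_num : 3 ∣ 6) (show 6 ∣ m from h6 ▸ hdvd), le_rfl⟩
    refine ⟨j₃, 1, Or.inl hj₃, IsIsogenous.trans ?_ ((isIsogenous_biproduct_of_subsingleton (0 : Fin 1) fun _ => C j₃).symm')⟩
    exact isIsogenous_of_level_eq_twice (n := 3) ⟨1, rfl⟩ le_rfl h6 hj₃ (hΨ j) (hΨ j₃) (hC j) (hC j₃)
  · -- `X_{12} ∼ X_4²`
    obtain ⟨j₄, hj₄⟩ := (hlev 4).2 ⟨dvd_trans (by norm_num : 4 ∣ 12) (show 12 ∣ m from h12 ▸ hdvd), by norm_num⟩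
    exact ⟨j₄, 2, Or.inr (Or.inl hj₄),
      isIsogenous_biproduct_two_of_level_eq_twelve_four h12 hj₄ (hΨ j) (hΨ j₄) (hC j) (hC j₄)⟩

/-- `n` is not a square if no `r ≤ n` squares to it. [folklore] -/
private theorem not_isSquare_of_forall' {n : ℕ} (h : ∀ r, r ≤ n → r * r ≠ n) : ¬IsSquare n :=
  fun ⟨r, hr⟩ => h r (hr ▸ Nat.le_mul_self r) hr.symm

/-- The discriminant products `d d'` for distinct levels among `3, 4, 8, 24` (`d = 3, 1, 2, 6`) are not squares. [cite: MoonenZarhin1999LowDim, Cor. (3.9)] -/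
private theorem not_isSquare_of_levels {e e' d d' : ℕ} (he : e = 3 ∨ e = 4 ∨ e = 8 ∨ e = 24) (he' : e' = 3 ∨ e' = 4 ∨ e' = 8 ∨ e' = 24)
    (hne : e ≠ e')
    (hd : (e = 3 ∨ e = 6) ∧ d = 3 ∨ (e = 4 ∨ e = 12) ∧ d = 1 ∨ e = 8 ∧ d = 2 ∨ e = 20 ∧ d = 5 ∨ e = 24 ∧ d = 6)
    (hd' : (e' = 3 ∨ e' = 6) ∧ d' = 3 ∨ (e' = 4 ∨ e' = 12) ∧ d' = 1 ∨ e' = 8 ∧ d' = 2 ∨ e' = 20 ∧ d' = 5 ∨ e' = 24 ∧ d' = 6) :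
    ¬IsSquare (d * d') := by
  rcases hd with ⟨h1, rfl⟩ | ⟨h1, rfl⟩ | ⟨h1, rfl⟩ | ⟨h1, rfl⟩ | ⟨h1, rfl⟩ <;>
    rcases hd' with ⟨h2, rfl⟩ | ⟨h2, rfl⟩ | ⟨h2, rfl⟩ | ⟨h2, rfl⟩ | ⟨h2, rfl⟩ <;>
    first | (exfalso; omega) | exact not_isSquare_of_forall' (by decide)

/-- **THE HODGE CONJECTURE FOR EVERYTHING ISOGENOUS TO A PRODUCT OF THE CM PIECES OF `J_m`, `m ∣ 24` (and `𝓑^p = 𝓓^p` for every `p`).**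
Let `m ≥ 3` divide `24`, and let `(C_j ⊨ (ℚ(ζ_{e_j}); Ψ_j))_j` be realisations of the lower-half types with exactly one member at each
divisor `e ≥ 3` of `m` (the Thm.-3.0 decomposition `J_m ∼ ∏_{d ∣ m, d ≥ 3} X_d` read as hypothesis).  Then every complex abelian variety `X`
ISOGENOUS to a product `⨁_{k<N} C_{π k}` (`π : Fin N → κ` arbitrary — all `∏_j C_j^{n_j}`) satisfies `𝓑^p(X) ⊗ ℂ = 𝓓^p(X) ⊗ ℂ` for every
`p` and the Hodge conjecture.  PROOF: contract to the members of levels `3, 4, 8, 24` (§3) and flatten (tree `exists_isIsogenous_biproduct_flatten`);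
these realise types induced from imaginary quadratic fields `ℚ(√−3), ℚ(i), ℚ(√−2), ℚ(√−6)` (§2), a nondegenerate family since `d d'` is never a
square (Moonen–Zarhin Cor. 3.9, tree `isNondegenerateFamily_of_sq_eq_neg`); conclude by Gordon 7.5 (3) ⟹ (1) up to isogeny with Shimura §6.2
Thm. 3 (tree `CMAlgebra.IsNondegenerateFamily.hodge…_of_isIsogenous_prod_inducedCMType`).  A KNOWN case (products of CM elliptic curves);
nothing here bears on the open cases of the Hodge conjecture. [cite: GalleseGoodsonLombardo2024, §3 Thm. 3.0, §3.3–§3.4 and Lemma 14]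
[cite: MoonenZarhin1999LowDim, Cor. (3.9)] [cite: Gordon1999HodgeAVSurvey, 7.5, 7.6.1 and 10.10] [cite: Shimura1998, §6.2 Thm. 3] -/
theorem hodge_of_isIsogenous_prod_of_dvd_twentyFour {m : ℕ} (hm : 3 ≤ m) (hm24 : m ∣ 24)
    (hlev : ∀ d, (∃ j, lev j = d) ↔ d ∣ m ∧ 3 ≤ d) (hinj : Function.Injective lev)
    (hΨ : ∀ j (σ : F j →+* ℂ), σ ∈ (Ψ j).1 ↔ 2 * (expOf (lev j) (F j) σ).val < lev j)
    (hC : ∀ j, IsCMTypeRealisation (Ψ j) (C j) (ιC j) (θC j)) {N : ℕ} (π : Fin N → κ) {X : AbelianVariety ℂ}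
    (hX : IsIsogenous X (⨁ fun k : Fin N => C (π k))) :
    (∀ p, hodgeClassSpan X.dim X.X p = divisorClassesSpan X.X X.dim p) ∧ HodgeConjectureFor X.dim X.X := by
  classical
  -- §3: contract every member to a power of a member of level `3, 4, 8, 24`, and flatten the product
  choose r h hr hCr using exists_isIsogenous_biproduct_const_of_dvd_twentyFour hm24 hlev hΨ hC
  obtain ⟨N', π', hflat⟩ := exists_isIsogenous_biproduct_flatten (A := C) (fun j => C (r j)) h hCr π
  -- the separating sub-family `S` of levels `3, 4, 8, 24`
  let S := {j : κ // lev j = 3 ∨ lev j = 4 ∨ lev j = 8 ∨ lev j = 24}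
  let ϖ : Fin N' → S := fun k => ⟨r (π' k), hr (π' k)⟩
  have hX' : IsIsogenous X (⨁ fun k : Fin N' => C (ϖ k).1) := hX.trans hflat
  have hmem : m ∈ Nat.divisors 24 := Nat.mem_divisors.2 ⟨hm24, by norm_num⟩
  have key : ∀ e ∈ Nat.divisors 24, 3 ≤ e → 3 ∣ e ∨ 4 ∣ e := by decide
  obtain ⟨j₀, hj₀⟩ : ∃ j, lev j = 3 ∨ lev j = 4 ∨ lev j = 8 ∨ lev j = 24 := by
    rcases key m hmem hm with h3 | h4
    · obtain ⟨j, hj⟩ := (hlev 3).2 ⟨h3, le_rfl⟩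
      exact ⟨j, Or.inl hj⟩
    · obtain ⟨j, hj⟩ := (hlev 4).2 ⟨h4, by norm_num⟩
      exact ⟨j, Or.inr (Or.inl hj)⟩
  haveI : Nonempty S := ⟨⟨j₀, hj₀⟩⟩
  -- the cyclotomic fields are CM
  have h2 : ∀ j, 2 < lev j := fun j => by have := ((hlev (lev j)).1 ⟨j, rfl⟩).2; omega
  haveI : ∀ j, IsCMField (F j) := fun j =>
    IsCyclotomicExtension.Rat.isCMField (F j) (S := {lev j}) ⟨lev j, rfl, h2 j⟩
  -- §2: descents to imaginary quadratic fields on `S`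
  have hS7 : ∀ s : S, lev s.1 = 3 ∨ lev s.1 = 4 ∨ lev s.1 = 6 ∨ lev s.1 = 8 ∨ lev s.1 = 12 ∨ lev s.1 = 20 ∨ lev s.1 = 24 :=
    fun s => by rcases s.2 with h | h | h | h <;> omega
  choose K₁ Φ₁ a d hind hdeg ha hd using fun s : S => exists_quadratic_subpair (hS7 s) (Ψ s.1) (hΨ s.1)
  haveI : ∀ s : S, IsCMField (K₁ s) := fun s => isCMField_of_cmType_intermediateField (K₁ s) (Φ₁ s)
  have hpair : ∀ s t : S, s ≠ t → ¬IsSquare (d s * d t) := fun s t hst =>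
    not_isSquare_of_levels s.2 t.2 (fun h => hst (Subtype.ext (hinj h))) (hd s) (hd t)
  have hnd : CMAlgebra.IsNondegenerateFamily Φ₁ := isNondegenerateFamily_of_sq_eq_neg (K := fun s : S => K₁ s) hdeg ha hpair Φ₁
  have hA' : ∀ s : S, IsCMTypeRealisation (inducedCMType (algebraMap (K₁ s) (F s.1)) (Φ₁ s)) (C s.1) (ιC s.1) (θC s.1) :=
    fun s => by rw [hind s]; exact hC s.1
  exact ⟨fun p => hnd.hodgeClassSpan_eq_divisorClassesSpan_of_isIsogenous_prod_inducedCMType (A := fun s : S => C s.1)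
      (fun s => algebraMap (K₁ s) (F s.1)) hA' ϖ hX' p,
    hnd.hodgeConjectureFor_of_isIsogenous_prod_inducedCMType (A := fun s : S => C s.1)
      (fun s => algebraMap (K₁ s) (F s.1)) hA' ϖ hX'⟩

/-- **The same for products indexed by any finite type** (`X ∼ ⨁_{i : ι} C_{f i}`). [cite: GalleseGoodsonLombardo2024, §3 Thm. 3.0]
[cite: MoonenZarhin1999LowDim, Cor. (3.9)] [cite: Gordon1999HodgeAVSurvey, 7.5 and 10.10] -/
theorem hodge_of_isIsogenous_prod_of_dvd_twentyFour' {m : ℕ} (hm : 3 ≤ m) (hm24 : m ∣ 24)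
    (hlev : ∀ d, (∃ j, lev j = d) ↔ d ∣ m ∧ 3 ≤ d) (hinj : Function.Injective lev)
    (hΨ : ∀ j (σ : F j →+* ℂ), σ ∈ (Ψ j).1 ↔ 2 * (expOf (lev j) (F j) σ).val < lev j)
    (hC : ∀ j, IsCMTypeRealisation (Ψ j) (C j) (ιC j) (θC j)) {ι : Type} [Fintype ι] [DecidableEq ι] (f : ι → κ)
    {X : AbelianVariety ℂ} (hX : IsIsogenous X (⨁ fun i : ι => C (f i))) :
    (∀ p, hodgeClassSpan X.dim X.X p = divisorClassesSpan X.X X.dim p) ∧ HodgeConjectureFor X.dim X.X :=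
  hodge_of_isIsogenous_prod_of_dvd_twentyFour hm hm24 hlev hinj hΨ hC (fun k => f ((Fintype.equivFin ι).symm k))
    (hX.trans (isIsogenous_biproduct_reindex (Fintype.equivFin ι).symm fun i => C (f i)).symm')

/-- **THE HODGE CONJECTURE FOR `J_m`, `m ∣ 24`** — for the biproduct `⨁_j C_j` of the Thm.-3.0 decomposition itself (`𝓑^p = 𝓓^p` for all
`p`, and `HodgeConjectureFor`); `m ∈ {3, 4, 6, 8, 12, 24}`: `J_m` is isogenous to a product of CM elliptic curves (F29) with CM by
`ℚ(√−3), ℚ(i), ℚ(√−2), ℚ(√−6)`. [cite: GalleseGoodsonLombardo2024, §1 (p. 4) and §3 Thm. 3.0] [cite: MoonenZarhin1999LowDim, Cor. (3.9)]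
[cite: Gordon1999HodgeAVSurvey, 7.5 and 10.10] -/
theorem hodge_biproduct_of_dvd_twentyFour {m : ℕ} (hm : 3 ≤ m) (hm24 : m ∣ 24)
    (hlev : ∀ d, (∃ j, lev j = d) ↔ d ∣ m ∧ 3 ≤ d) (hinj : Function.Injective lev)
    (hΨ : ∀ j (σ : F j →+* ℂ), σ ∈ (Ψ j).1 ↔ 2 * (expOf (lev j) (F j) σ).val < lev j)
    (hC : ∀ j, IsCMTypeRealisation (Ψ j) (C j) (ιC j) (θC j)) :
    (∀ p, hodgeClassSpan (⨁ C).dim (⨁ C).X p = divisorClassesSpan (⨁ C).X (⨁ C).dim p) ∧ HodgeConjectureFor (⨁ C).dim (⨁ C).X := by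
  classical
  exact hodge_of_isIsogenous_prod_of_dvd_twentyFour' hm hm24 hlev hinj hΨ hC id (IsIsogenous.refl _)

/-- **THE HODGE CONJECTURE FOR ALL POWERS `J_mⁿ`, `m ∣ 24`** (and everything isogenous to one): `𝓑^p = 𝓓^p` for all `p` — the Hodge ring of
`J_mⁿ` is generated by divisor classes (stably nondegenerate) — and `HodgeConjectureFor`. [cite: GalleseGoodsonLombardo2024, §1 (p. 4) and §3 Thm. 3.0]
[cite: MoonenZarhin1999LowDim, Cor. (3.9)] [cite: Gordon1999HodgeAVSurvey, 7.5, 7.6.1 and 10.10] -/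
theorem hodge_of_isIsogenous_pow_biproduct_of_dvd_twentyFour {m : ℕ} (hm : 3 ≤ m) (hm24 : m ∣ 24)
    (hlev : ∀ d, (∃ j, lev j = d) ↔ d ∣ m ∧ 3 ≤ d) (hinj : Function.Injective lev)
    (hΨ : ∀ j (σ : F j →+* ℂ), σ ∈ (Ψ j).1 ↔ 2 * (expOf (lev j) (F j) σ).val < lev j)
    (hC : ∀ j, IsCMTypeRealisation (Ψ j) (C j) (ιC j) (θC j)) (n : ℕ) {X : AbelianVariety ℂ}
    (hX : IsIsogenous X (⨁ fun _ : Fin n => ⨁ C)) :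
    (∀ p, hodgeClassSpan X.dim X.X p = divisorClassesSpan X.X X.dim p) ∧ HodgeConjectureFor X.dim X.X := by
  classical
  have h1 : IsIsogenous (⨁ fun _ : Fin n => ⨁ C) (⨁ fun q : (_ : Fin n) × κ => C q.2) :=
    isIsogenous_biproduct_biproduct_sigma fun (_ : Fin n) (j : κ) => C j
  exact hodge_of_isIsogenous_prod_of_dvd_twentyFour' hm hm24 hlev hinj hΨ hC (fun q : (_ : Fin n) × κ => q.2) (hX.trans h1)

end Family

/-! ## §5 One elliptic level: every abelian variety isogenous to a power of `X_d`, `d ∈ {3, 4, 6, 8, 12, 20, 24}`, satisfies the Hodge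
## conjecture (powers of one CM elliptic curve) -/

section OneLevel

variable {N : ℕ} [NeZero N] {K : Type} [Field K] [NumberField K] [IsCyclotomicExtension {N} ℚ K] {Φ : CMType K}
  {A : AbelianVariety ℂ} {ι : 𝓞 K →+* End A} {θ : K →+* Module.End ℂ (complexBetti A.X 1)}

/-- **At an elliptic level `d ∈ {3, 4, 6, 8, 12, 20, 24}` every abelian variety isogenous to a power `X_dⁿ` of a realisation of the lower-half
type has `𝓑^p = 𝓓^p` for all `p` and satisfies the Hodge conjecture** (`X_d ∼ Eʰ` for ONE CM elliptic curve `E` with CM by `ℚ(√−d')`, §2;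
a one-member family of an imaginary quadratic field is nondegenerate). [cite: GalleseGoodsonLombardo2024, §3 Thm. 3.0 and §3.4]
[cite: MoonenZarhin1999LowDim, Cor. (3.9)] [cite: Gordon1999HodgeAVSurvey, 7.5 and 10.10] -/
theorem hodge_of_isIsogenous_pow_of_ellipticLevel (hN : N = 3 ∨ N = 4 ∨ N = 6 ∨ N = 8 ∨ N = 12 ∨ N = 20 ∨ N = 24)
    (hΦ : ∀ σ : K →+* ℂ, σ ∈ Φ.1 ↔ 2 * (expOf N K σ).val < N) (hA : IsCMTypeRealisation Φ A ι θ) (n : ℕ) {X : AbelianVariety ℂ}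
    (hX : IsIsogenous X (⨁ fun _ : Fin n => A)) :
    (∀ p, hodgeClassSpan X.dim X.X p = divisorClassesSpan X.X X.dim p) ∧ HodgeConjectureFor X.dim X.X := by
  have h2 : 2 < N := by omega
  haveI : IsCMField K := IsCyclotomicExtension.Rat.isCMField K (S := {N}) ⟨N, rfl, h2⟩
  obtain ⟨K₁, Φ₁, a, d, hind, hdeg, ha, -⟩ := exists_quadratic_subpair hN Φ hΦ
  haveI : IsCMField K₁ := isCMField_of_cmType_intermediateField K₁ Φ₁
  have hnd : CMAlgebra.IsNondegenerateFamily (fun _ : Unit => Φ₁) :=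
    isNondegenerateFamily_of_sq_eq_neg (K := fun _ : Unit => K₁) (d := fun _ => d) (a := fun _ => a) (fun _ => hdeg) (fun _ => ha)
      (fun i j hij => absurd (Subsingleton.elim i j) hij) _
  have hA' : ∀ _u : Unit, IsCMTypeRealisation (inducedCMType (algebraMap K₁ K) Φ₁) A ι θ := fun _ => by rw [hind]; exact hA
  exact ⟨fun p => hnd.hodgeClassSpan_eq_divisorClassesSpan_of_isIsogenous_prod_inducedCMType (A := fun _ : Unit => A)
      (fun _ => algebraMap K₁ K) hA' (fun _ : Fin n => ()) hX p,
    hnd.hodgeConjectureFor_of_isIsogenous_prod_inducedCMType (A := fun _ : Unit => A) (fun _ => algebraMap K₁ K) hA'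
      (fun _ : Fin n => ()) hX⟩

end OneLevel

end HyperellipticJacobian

end Literature.AlgebraicGeometry.ComplexMultiplication

end
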